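import Summits.FinalStateConjecture.FinalStateConjecture.Theses.KerrnessPropagates
import Literature.Geometry.Lorentzian.TameGenericityDiagonal

/-!
# Route `KerrnessPropagates`, crux `KerrBasinCapture` (stmt-FinalStateConjecture-17646), line `registered` —
# calibration: the crux contains TAME WEAK COSMIC CENSORSHIP

The line `registered` (skeleton `Cruxes/KerrBasinCapture/Lines/birth.lean`, rev 11) closes the crux
modulo ONE registered stub, `stub_tameOmegaCapture`, whose composition `KerrBasinCapture_of` is
kernel-checked: `stub_tameOmegaCapture → KerrBasinCapture`. This file records, sorry-free, where the
crux (hence the stub) sits among the registered open statements of the summit: together with the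
route's MGHD-existence item `MaximalDevelopmentExists` (stmt-FinalStateConjecture-9937, the
Choquet-Bruhat–Geroch theorem over `VacuumCauchyDevelopment`) the crux implies

* tame weak cosmic censorship — verbatim the body of the route item
  `Summit.FinalStateConjecture.FinalStateConjecture.Theses.PhaseMixingCapture.WeakCosmicCensorshipTame`
  (registered open problem of route `PhaseMixingCapture`): tame-Christodoulou-generically in the
  admissible class, an MGHD exists and every MGHD has complete future null infinity
  (`weakCosmicCensorshipTame_of_kerrBasinCapture`);
* hence plain Christodoulou-generic weak cosmic censorship over `VacuumCauchyDevelopment` — verbatim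
  the body of `…PhaseMixingCapture.WeakCosmicCensorshipMGHD` (stmt-FinalStateConjecture-9952)
  (`weakCosmicCensorshipMGHD_of_kerrBasinCapture`).

Both are one application of monotonicity of tame genericity in the property
(`InitialDataSet.IsTameChristodoulouGeneric.mono`) at regularity `k = 0`, forgetting recurrence and
the interior lemma. Weak cosmic censorship for the vacuum equations without symmetry is open
(Christodoulou, CQG 16 (1999) A23, p. A24; "not much progress has been made on either of these cosmic
censorship problems in the general case", Ashtekar–Berger–Isenberg–MacCallum (eds.), *General
Relativity and Gravitation: A Centennial Perspective* (2015), p. 586), which is why the remaining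
stub of the line is crux-sized and not a worker's task. The conclusions are stated verbatim rather
than by the foreign route's names so that this file does not couple the two route files.
-/

open scoped Manifold ContDiff
open Literature.Geometry.Lorentzian

-- D-0017: single-problem summit, `Summit.<S>.<S>.…` by design.
set_option linter.dupNamespace false

namespace Summit.FinalStateConjecture.FinalStateConjecture.Theorems.KerrnessPropagates.KerrBasinCapture

/-- **The crux contains tame weak cosmic censorship.** `KerrBasinCapture` (at regularity `k = 0`)
together with MGHD existence for admissible data (`MaximalDevelopmentExists`) implies: for every
data manifold `X`, tame-Christodoulou-generically in `admissibleVacuumData X`, a maximal vacuum Cauchy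
development exists and every maximal vacuum Cauchy development has complete future null infinity —
verbatim the body of `Theses.PhaseMixingCapture.WeakCosmicCensorshipTame`. Proof: monotonicity of
tame genericity in the property (`IsTameChristodoulouGeneric.mono`), dropping recurrence and the
interior lemma and adding the pointwise MGHD existence. -/
theorem weakCosmicCensorshipTame_of_kerrBasinCapture
    (hcap : Summit.FinalStateConjecture.FinalStateConjecture.Theses.KerrnessPropagates.KerrBasinCapture)
    (hmghd : Summit.FinalStateConjecture.FinalStateConjecture.Theses.KerrnessPropagates.MaximalDevelopmentExists) :
    ∀ (X : Type) [TopologicalSpace X] [ChartedSpace E3 X] [IsManifold (𝓡 3) ((⊤ : ℕ∞) : WithTop ℕ∞) X]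
      [T2Space X] [SecondCountableTopology X] [ConnectedSpace X],
      InitialDataSet.IsTameChristodoulouGeneric (admissibleVacuumData X)
        (fun D ↦ (∃ 𝒟 : VacuumCauchyDevelopment D, 𝒟.IsMaximal) ∧
          ∀ 𝒟 : VacuumCauchyDevelopment D, 𝒟.IsMaximal →
            Summit.FinalStateConjecture.HasCompleteNullInfinity 𝒟.toCauchyDevelopment) 1 := by
  intro X _ _ _ _ _ _
  exact InitialDataSet.IsTameChristodoulouGeneric.mono (hcap 0 X)
    fun D hD hQ ↦ ⟨hmghd X D hD, fun 𝒟 h𝒟 ↦ (hQ 𝒟 h𝒟).1⟩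

/-- **The crux contains Christodoulou-generic weak cosmic censorship** (topology-free genericity,
over `VacuumCauchyDevelopment`): verbatim the body of
`Theses.PhaseMixingCapture.WeakCosmicCensorshipMGHD`, from the tame version by
`IsTameChristodoulouGeneric.isChristodoulouGeneric`. -/
theorem weakCosmicCensorshipMGHD_of_kerrBasinCapture
    (hcap : Summit.FinalStateConjecture.FinalStateConjecture.Theses.KerrnessPropagates.KerrBasinCapture)
    (hmghd : Summit.FinalStateConjecture.FinalStateConjecture.Theses.KerrnessPropagates.MaximalDevelopmentExists) :
    ∀ (X : Type) [TopologicalSpace X] [ChartedSpace E3 X] [IsManifold (𝓡 3) ((⊤ : ℕ∞) : WithTop ℕ∞) X]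
      [T2Space X] [SecondCountableTopology X] [ConnectedSpace X],
      InitialDataSet.IsChristodoulouGeneric (admissibleVacuumData X)
        (fun D ↦ (∃ 𝒟 : VacuumCauchyDevelopment D, 𝒟.IsMaximal) ∧
          ∀ 𝒟 : VacuumCauchyDevelopment D, 𝒟.IsMaximal →
            Summit.FinalStateConjecture.HasCompleteNullInfinity 𝒟.toCauchyDevelopment) 1 :=
  fun X _ _ _ _ _ _ ↦ (weakCosmicCensorshipTame_of_kerrBasinCapture hcap hmghd X).isChristodoulouGeneric

end Summit.FinalStateConjecture.FinalStateConjecture.Theorems.KerrnessPropagates.KerrBasinCapture
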